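import Literature.NumberTheory.Transcendental.KZFibredRelations
import Literature.NumberTheory.Transcendental.KZProductIdeal
import Summits.KontsevichZagierPeriods.KontsevichZagierPeriods.Theorems.TerasomaMultiplicationBetaCancellationOfAyoubPiCancellation

/-!
# `BetaCancellation` (stmt-KontsevichZagierPeriods-13633), line `dirichlet-companion-to-pi` — stub `stub_slabDescent`

**Slab descent.** For a family `P n r : IntegralRep (n + 2)` pinned as "unit disc in the two
leading coordinates, `r` in the trailing `n`", a FIBRED certificate
`FreeAbelianGroup.lift (of ∘ P) c ∈ KZ.fibredRelations` (moves uniform in the parameter `z 0`, the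
first disc coordinate) descends to every rational slab `{a < z 0 < b}`:
`[[π]|{a < x < b}] * c ∈ KZ.relations`.

Proof. Slab restriction `KZ.slabMap a b : FormalRep →+ FormalRep` preserves fibred relations
(`KZ.slabMap_mem_fibredRelations`) and fibred relations are relations
(`KZ.fibredRelations_le_relations`), so `slabMap a b (lift (of ∘ P) c) ∈ relations`. On the other
hand `slabMap a b (lift (of ∘ P) c)` and `[[π]|slab] * c` are both additive in `c` and differ by a
relation on every generator `[t]`: `slabMap a b [P t] = [(P t)|slab]`, and `(P t)|slab` IS the
reindexing `((([π]|slab) × t).reindex (Fin (2 + m) ≃ Fin (m + 2)))` of the product representation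
(`KZ.IntegralRep.ext'`: same domain, same integrand), which differs from
`[[π]|slab] * [t] = [([π]|slab) × t]` (`KZ.of_mul_of`) by one rule-(2) move
(`KZ.of_sub_of_reindex_mem_relations`). Induction on the free abelian group (pattern of
`piRep_mul_sub_lift_mem_relations`). The reindexing lemmas are stated for any `q : IntegralRep 2`
with the domain and integrand of `[π]|slab` (instantiated by `rfl`), so that the coordinate
bookkeeping runs in the literal dimension `2`. No definitions; sorry-free;
axioms ⊆ {propext, Classical.choice, Quot.sound}.

References: M. Kontsevich, D. Zagier, *Periods* (2001), §1.2 rules (1)–(3); J. Ayoub, *Une version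
relative de la conjecture des périodes de Kontsevich–Zagier*, Ann. of Math. 181 (2015), §1.
-/

noncomputable section

-- `Summit.KontsevichZagierPeriods.KontsevichZagierPeriods.…` is the tree's mandated layout (single-conjunct summit).
set_option linter.dupNamespace false

namespace Summit.KontsevichZagierPeriods.KontsevichZagierPeriods.BetaCancellationLine

open Set
open Literature.NumberTheory.Transcendental
open Literature.NumberTheory.Transcendental.KZ

/-! ### The slab restriction of the pinned family is the reindexed `([π]|slab) × t` -/

/-- **The slab restriction of a pinned family is the reindexed `q × t`** for any `q : IntegralRep 2`
with the domain `disc ∩ {a < z 0 < b}` and the integrand `1` of `[π]|slab` (same domain and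
integrand; the remaining fields of `IntegralRep` are proofs, `KZ.IntegralRep.ext'`). [folklore] -/
theorem pinned_slabRestrict_eq_reindex
    (P : ∀ n : ℕ, IntegralRep n → IntegralRep (n + 2))
    (hP : ∀ (n : ℕ) (r : IntegralRep n),
      (P n r).domain = {z : Fin (n + 2) → ℝ | z 0 ^ 2 + z 1 ^ 2 ≤ 1 ∧ (fun i : Fin n => z i.succ.succ) ∈ r.domain} ∧
      (P n r).integrand = fun z => r.integrand (fun i : Fin n => z i.succ.succ))
    (a b : ℚ) {q : IntegralRep 2} (hq : q.domain = piDisc ∩ paramSlab 1 a b)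
    (hq' : q.integrand = fun _ => 1) (m : ℕ) (t : IntegralRep m) :
    (P m t).slabRestrict a b = (q.prod t).reindex (finCongr (Nat.add_comm 2 m)) := by
  refine IntegralRep.ext' ?_ ?_
  · ext z
    simp only [IntegralRep.domain_slabRestrict, (hP m t).1, IntegralRep.reindex_domain,
      IntegralRep.prod_domain, IntegralRep.mem_prodDomain, hq, mem_inter_iff, mem_setOf_eq,
      mem_piDisc, mem_paramSlab, piIndex_castAdd_zero, piIndex_castAdd_one, piIndex_natAdd]
    exact and_right_comm
  · funext z
    simp only [IntegralRep.integrand_slabRestrict, (hP m t).2, IntegralRep.reindex_integrand,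
      IntegralRep.prod_integrand_eq, IntegralRep.prodFun, hq', one_mul, piIndex_natAdd]

/-- For such a `q`: `[q × t] − [(P t)|slab] ∈ relations` (one coordinate relabelling,
`KZ.of_sub_of_reindex_mem_relations`). [folklore] -/
theorem of_prod_sub_of_pinned_slabRestrict_mem_relations
    (P : ∀ n : ℕ, IntegralRep n → IntegralRep (n + 2))
    (hP : ∀ (n : ℕ) (r : IntegralRep n),
      (P n r).domain = {z : Fin (n + 2) → ℝ | z 0 ^ 2 + z 1 ^ 2 ≤ 1 ∧ (fun i : Fin n => z i.succ.succ) ∈ r.domain} ∧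
      (P n r).integrand = fun z => r.integrand (fun i : Fin n => z i.succ.succ))
    (a b : ℚ) {q : IntegralRep 2} (hq : q.domain = piDisc ∩ paramSlab 1 a b)
    (hq' : q.integrand = fun _ => 1) (m : ℕ) (t : IntegralRep m) :
    of (q.prod t) - of ((P m t).slabRestrict a b) ∈ relations := by
  rw [pinned_slabRestrict_eq_reindex P hP a b hq hq' m t]
  exact of_sub_of_reindex_mem_relations _ _

/-- On a generator: `[[π]|slab] * [t] − [(P t)|slab] ∈ relations` (`KZ.of_mul_of`, then
`of_prod_sub_of_pinned_slabRestrict_mem_relations` for `q := [π]|slab`). [folklore] -/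
theorem of_piSlab_mul_of_sub_of_slabRestrict_mem_relations
    (P : ∀ n : ℕ, IntegralRep n → IntegralRep (n + 2))
    (hP : ∀ (n : ℕ) (r : IntegralRep n),
      (P n r).domain = {z : Fin (n + 2) → ℝ | z 0 ^ 2 + z 1 ^ 2 ≤ 1 ∧ (fun i : Fin n => z i.succ.succ) ∈ r.domain} ∧
      (P n r).integrand = fun z => r.integrand (fun i : Fin n => z i.succ.succ))
    (a b : ℚ) (m : ℕ) (t : IntegralRep m) :
    of (piRep.slabRestrict a b) * of t - of ((P m t).slabRestrict a b) ∈ relations := by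
  rw [of_mul_of]
  exact of_prod_sub_of_pinned_slabRestrict_mem_relations P hP a b (q := piRep.slabRestrict a b)
    rfl rfl m t

/-- **`[[π]|slab] * c` is `slabMap a b (lift (of ∘ P) c)` modulo relations**: both sides are
additive in `c`, and on generators this is `of_piSlab_mul_of_sub_of_slabRestrict_mem_relations`.
[folklore] -/
theorem piSlab_mul_sub_slabMap_lift_mem_relations
    (P : ∀ n : ℕ, IntegralRep n → IntegralRep (n + 2))
    (hP : ∀ (n : ℕ) (r : IntegralRep n),
      (P n r).domain = {z : Fin (n + 2) → ℝ | z 0 ^ 2 + z 1 ^ 2 ≤ 1 ∧ (fun i : Fin n => z i.succ.succ) ∈ r.domain} ∧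
      (P n r).integrand = fun z => r.integrand (fun i : Fin n => z i.succ.succ))
    (a b : ℚ) (c : FormalRep) :
    of (piRep.slabRestrict a b) * c -
        slabMap a b (FreeAbelianGroup.lift (fun s : (Σ n, IntegralRep n) => of (P s.1 s.2)) c) ∈
      relations := by
  induction c using FreeAbelianGroup.induction_on with
  | zero => simp [relations.zero_mem]
  | of s =>
    obtain ⟨m, t⟩ := s
    rw [FreeAbelianGroup.lift_apply_of, slabMap_of]
    exact of_piSlab_mul_of_sub_of_slabRestrict_mem_relations P hP a b m t
  | neg s ih =>
    rw [mul_neg, map_neg, map_neg, ← neg_sub']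
    exact relations.neg_mem ih
  | add x y hx hy =>
    rw [mul_add, map_add, map_add, ← sub_add_sub_comm]
    exact relations.add_mem hx hy

/-! ### The stub -/

/-- **STUB 1 (slab descent)**: a fibred certificate for the pinned disc family restricts to every
rational slab of the first disc coordinate — if `lift (of ∘ P) c` is a fibred relation then
`[[π]|{a < x < b}] * c` is a relation, for all rational `a b`. [folklore] -/
theorem stub_slabDescent :
    ∀ (P : ∀ n : ℕ, IntegralRep n → IntegralRep (n + 2)),
      (∀ (n : ℕ) (r : IntegralRep n), (P n r).domain = {z : Fin (n + 2) → ℝ | z 0 ^ 2 + z 1 ^ 2 ≤ 1 ∧ (fun i : Fin n => z i.succ.succ) ∈ r.domain} ∧ (P n r).integrand = fun z => r.integrand (fun i : Fin n => z i.succ.succ)) →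
      ∀ (c : FormalRep) (a b : ℚ),
        FreeAbelianGroup.lift (fun s : (Σ n, IntegralRep n) => of (P s.1 s.2)) c ∈ fibredRelations →
        of (piRep.slabRestrict a b) * c ∈ relations := by
  intro P hP c a b hc
  have h₁ : slabMap a b (FreeAbelianGroup.lift (fun s : (Σ n, IntegralRep n) => of (P s.1 s.2)) c) ∈
      relations :=
    fibredRelations_le_relations (slabMap_mem_fibredRelations hc a b)
  have h₂ := piSlab_mul_sub_slabMap_lift_mem_relations P hP a b c
  simpa using relations.add_mem h₂ h₁

end Summit.KontsevichZagierPeriods.KontsevichZagierPeriods.BetaCancellationLine
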